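import Summits.QuantumFields.YangMills.Theorems.BalabanUVNodesK0AxMomentBox

/-!
# LANDING NOTE (porter PTC-1 g3; ★ P3 g89's THIRD-FILE OFFER 2026-08-31T07:28:31Z; AUTHORSHIP = ★ P3 g89, HOME sketch `nodeO-cover/P3-K0AxMomentBox-v2.lean` 6587fefcb2367846).
# THIS FILE `…K0AxMomentBoxSocket.lean` = the sketch's K1ᴬ SOCKET FACE (`CofinalBetaSocketAxBody F a` — the body of the K0ᴬ–K1ᴬ junction's binder `hβc` as a NAMED hypothesis shape,
# with parameters; its projection to door (α_cof)-Ax; what (L-absmom-box) feeds of it and what stays displayed) + §5d the [E]-HEADED RATE-FREE DOORS (★★★ №526 (i): [E]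
# `K0AxTwoVolumeRate.RecordPvolTwoVolExpOnRunsAx` = the common first letter; here in MOMENT currency, threshold ⟹ inhabitation only).  Companion of ✓`…K0AxMomentBox.lean`
# (same namespace `…Theorems.K0AxMomentRoad`).  Declarations and proofs byte-identical to the sketch.
-/

/-!
# LENS P3 «weaken the target» — THE BOX TWIN OF THE MOMENT DOOR AND ITS K1ᴬ SOCKET FACE (★ P3 g89, sketch `nodeO-cover/P3-K0AxMomentBox-v1.lean`)

Third file of the moment road, after ▶ PTC-1 g3's landings of ★ P3 g89's v1: ✓p814271 `…K0AxMomentRoad.lean` (§1 generic rate-free analysis, §2 run letters, §4 JOIN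
shapes) and ✓p814339 `…K0AxMomentDoor.lean` (§3 run doors (μ_cof)-Ax `K0AbsMomentCofinalRadiiAx` ∕ (μ_cof^vol)-Ax `K0PvolAbsMomentCofinalRadiiAx` ⟹ K0ᴬ BY NAME) and ✓`…K0AxTwoVolumeRate.lean` (◇ lens-1 g8, ▶ PTC-1: the letter [E]) — the TWO
imports.  Same namespace `…Theorems.K0AxMomentRoad`.  DEDUP-SAFE: no theorem below has the statement of a landed declaration (the p814295 lesson: a second proof of a landed
statement is `dedup.landed`); the two roads to K0ᴬ are recorded as CONJUNCTIONS `doors_of_…`, never as same-statement twins.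

WHAT THIS FILE TYPES (the §5 of the HOME sketch `P3-K0AxMomentDoor-v1_1.lean` 746 l.: letters ∕ order ∕ K1ᴬ face byte-identical; the K0ᴬ doors re-proved through `doors_of_…`):
* (L-absmom-box) `RecordPlimAbsMomentOnBoxAx F a₀ ε₂₉ γ M` ∕ (V-absmom-box) `RecordPvolAbsMomentOnBoxAx F a₀ ε₂₉ γ M` — box-uniform (ONE `M` for all steps `k` and box
  histories `v`) absolute `(0,1)`-second moments of DEF-1's record kernels `recordPlimAx` ∕ (windowed, frequently in the volume) `recordPvolAx` of the `thetaFill` member;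
* their order: box (5.10)-decay receipts ⟹ box moments (`M := β′₅.₁₀`); dag-n07-w3's `∀ S : Finset, ∀ᶠ K` face shape ⟹ the window shape (`exists_window_of_forall_finset_eventually`,
  diagonal `Nat.findGreatest` thresholds along the monotone boxes `[−K, K]⁴`); ★ Fatou on the box `recordPlimAbsMomentOnBoxAx_of_pvol` (rate-free); box ⟹ runs;
* ★ `betaBox_thetaFill_of_recordPlimAbsMomentOnBoxAx`: (L-absmom-box) at level `γ ≤ ½` ⟹ `BetaUpperH M γ β ∧ BetaLowerH (−M) γ β` for `β := betaOfRecord₁₃Ax F 2 (thetaFill F a₀ ε₂₉)`;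
* doors (μ_cof^box)-Ax `K0AbsMomentBoxCofinalRadiiAx` ∕ (μ_cof^box,vol)-Ax `K0PvolAbsMomentBoxCofinalRadiiAx` (0-binder, cofinal radii) ⟹ door (α_cof)-Ax
  `K0V23Stub3DoorSuppliersAx.K0BoxCofinalRadiiAx` AND run door (μ_cof)-Ax (resp. (μ_cof^vol)-Ax) of ✓`…K0AxMomentDoor` — `doors_of_…`: the box moment door sits above
  BOTH roads — ⟹ ★★★ K0ᴬ `Record13SepCoPHInhabitedAx` BY NAME on k0's BOX road;
* the K0ᴬ–K1ᴬ junction's binder body `CofinalBetaSocketAxBody F a` (VERBATIM the text under `∀ F, ∀ a, 0 < a →` of the last binder of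
  `BalabanUVNodes.N24K0K1JunctionOfCofinalBetaSocketAx.k0BoxCofinalRadiiAx_of_cofinalBetaSocketAx`; restated, not imported, so this file stays junction-free) and ★★
  `cofinalBetaSocketAxBody_of_absMomentBox_of_floor_of_cont` — THE TYPED LENS-P3 EDGE TABLE AT K1ᴬ: (L-absmom-box) feeds the socket's |β| half (box `β′ := M` + row (i)
  `b := 0, r := M`); the partial-sum FLOOR (iv) (AF-sign, [I] (5.38)–(5.44)) and the history-CONTINUITY (C) ([I] §1 pp.263–264) stay DISPLAYED — they are in no
  kernel-size currency and were never fed by (5.10)-decay either, so the moment currency loses no K1ᴬ edge; K2ᴬ is proved, K3ᴬ is kernel-free.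
* §5d [E]-HEADED doors (★★★ №526 (i)): `joinConclVolMomR_of_twoVolExp_pvolAbsMoment_threshold` ([E] ∧ (V-absmom) in threshold form under the JOIN antecedents ⟹
  `JoinConclVolMomR`), ★★★ `record13SepCoPHInhabitedAx_of_twoVolExp_pvolAbsMoment_tokFree` (the RATE-FREE sibling of ✓`K0AxTwoVolumeRate.…_of_twoVolExp_pvolDecayEv_tokFree`:
  their rated `hDec` replaced by the weaker windowed-moment supply `hVmom`; P0 binders verbatim) and ★★★ `…_of_twoVolExp_pvolAbsMoment_cofinalRadii` ([E] ∧ (V-absmom) at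
  cofinal radii ⟹ K0ᴬ through (μ_cof^vol)-Ax; no P0, no JOIN).

PRIOR TREE ART (credit).  The moment currency ON THE BOX at EVERY radius is k0-s3-w2's repaired finite-volume currency (R1′)∕(R2′) re-homed in dag-n07-w3's
`K0V23Stub3FinVolSuppliersAx` (private `abs_secondMoment_polLimit_le_of_eventually`; ★★ `abs_betaOfRecord₁₃Ax_le_of_eventualAbsMomentOnBox`; ★★ `tokenFreeZBAx_of_momentFaceAtZB`
⟹ K0ᴬ via `K0V23Stub3DoorSuppliersAx.k0BoxSmallRadii_of_tokenFreeCore` + `record13SepCoPHInhabitedAx_of_k0BoxSmallRadii`).  Delta here: record names, COFINAL radii, the weaker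
window quantifier, the (α_cof) road, the K1ᴬ face.

HONEST.  CONDITIONAL helpers: every door ∕ letter is an OPEN Bałaban-strength hypothesis ([I] (1.21)–(1.22), (4.37), (5.42) at the record) — none proved; nothing of
Bałaban asserted, ported, discharged or refuted; K0ᴬ `stmt-QuantumFields-27238` OPEN; K1ᴬ OPEN; NODE O 0∕1; finite 𝕋⁴ at fixed `ε = L^(−K)` — NOT continuum ∕ OS ∕ Clay;
**the Yang–Mills mass gap is NOT proved by any of this.**  No `sorry` ∕ `instance` ∕ `notation`.
-/

noncomputable section

open scoped BigOperators Matrix.Norms.L2Operator Topology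
open Set Filter

namespace Summit.QuantumFields.YangMills.Theorems.K0AxMomentRoad

open Summit.QuantumFields.YangMills.Theorems.K0RecordFormatNames
open Summit.QuantumFields.YangMills.Theorems
open Summit.QuantumFields.YangMills.Theorems.PortHRecordJoin
open Summit.QuantumFields.YangMills.Theorems.K0AxTwoVolumeRate (RecordPvolTwoVolExpOnRunsAx recordPolLimitOnRunsAx_of_twoVolExp)
open Literature.MathematicalPhysics.QuantumFieldTheory.Balaban1983to89
open Literature.MathematicalPhysics.QuantumFieldTheory.Balaban1983to89.Node00
open Literature.MathematicalPhysics.QuantumFieldTheory.Balaban1983to89.T4Continuum (T4Family)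
open Literature.MathematicalPhysics.QuantumFieldTheory.Balaban1983to89.FlowStep
open Literature.MathematicalPhysics.QuantumFieldTheory.Balaban1983to89.FlowStepRuns
open Literature.MathematicalPhysics.QuantumFieldTheory.Balaban1983to89.B12Sec2to5 (l1 Decay510 betaPrime510 majorant_summable)

variable (F : T4Family) (a₀ ε₂₉ : ℝ)

/-! ### The K1ᴬ socket face: what (L-absmom-box) feeds of the K0ᴬ–K1ᴬ junction's binder `hβc`, and what stays displayed -/

/-- **THE BODY OF THE K0ᴬ–K1ᴬ JUNCTION's BINDER `hβc` AT `(F, a)`** — VERBATIM the text under `∀ F, ∀ a, 0 < a →` of the binder of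
`BalabanUVNodes.N24K0K1JunctionOfCofinalBetaSocketAx.k0BoxCofinalRadiiAx_of_cofinalBetaSocketAx` (the Ax K1 face's ∕ Ax engine's last binder: the |β|-box at a cofinal
re-centred print-regime member AND NODE O's run rows (i) centred, (iv) partial-sum floor, (C) history-continuity at SOME level `γ₁`).  A HYPOTHESIS SHAPE named here only
so that the moment face below can be stated against it; the junction file declares no `def` for it. [cite: Balaban1987RG1, Thm 1 p.259, Thm 3 p.264, (0.20) p.256, (1.20)–(1.22) p.264, (5.38)–(5.44) pp.296–297, §1 pp.263–264 (statement shapes)] -/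
def CofinalBetaSocketAxBody (F : T4Family) (a : ℝ) : Prop :=
  ∃ a₀ : ℝ, 0 < a₀ ∧ a₀ ≤ a ∧
    ∃ (γ₀ ε₂₉ β' : ℝ) (j : ℕ) (ε₀ B₃ B₃' a₁ : ℝ) (Efl logz : B12.RunParams → ℕ → ℝ), 0 < γ₀ ∧ 0 < ε₂₉ ∧
      BetaLowerH (-β') γ₀ (betaOfRecord₁₃Ax F 2 (theta13OfThm1CCMWZBAx F 2 j (1 / 2) a₀ ε₀ ε₂₉ B₃ B₃' a₀ a₁ Efl logz)) ∧
      BetaUpperH β' γ₀ (betaOfRecord₁₃Ax F 2 (theta13OfThm1CCMWZBAx F 2 j (1 / 2) a₀ ε₀ ε₂₉ B₃ B₃' a₀ a₁ Efl logz)) ∧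
      ∃ (b : ℕ → ℝ) (r γ₁ M : ℝ), 0 < γ₁ ∧
        (∀ (n : ℕ) (gs : ℕ → ℝ), RGEqH n (betaOfRecord₁₃Ax F 2 (theta13OfThm1CCMWZBAx F 2 j (1 / 2) a₀ ε₀ ε₂₉ B₃ B₃' a₀ a₁ Efl logz)) gs → Step.InInterval γ₁ n gs → ∀ k, k ≤ n → |betaOfRecord₁₃Ax F 2 (theta13OfThm1CCMWZBAx F 2 j (1 / 2) a₀ ε₀ ε₂₉ B₃ B₃' a₀ a₁ Efl logz) k (prefixOf gs k) - b k| ≤ r) ∧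
        (∀ (n : ℕ) (gs : ℕ → ℝ), RGEqH n (betaOfRecord₁₃Ax F 2 (theta13OfThm1CCMWZBAx F 2 j (1 / 2) a₀ ε₀ ε₂₉ B₃ B₃' a₀ a₁ Efl logz)) gs → Step.InInterval γ₁ n gs → ∀ k, k ≤ n → -M ≤ ∑ i ∈ Finset.Ico k n, betaOfRecord₁₃Ax F 2 (theta13OfThm1CCMWZBAx F 2 j (1 / 2) a₀ ε₀ ε₂₉ B₃ B₃' a₀ a₁ Efl logz) i (prefixOf gs i)) ∧
        ∀ k : ℕ, ContinuousOn (fun x : ℝ => betaOfRecord₁₃Ax F 2 (theta13OfThm1CCMWZBAx F 2 j (1 / 2) a₀ ε₀ ε₂₉ B₃ B₃' a₀ a₁ Efl logz) k (clampPrefix (betaOfRecord₁₃Ax F 2 (theta13OfThm1CCMWZBAx F 2 j (1 / 2) a₀ ε₀ ε₂₉ B₃ B₃' a₀ a₁ Efl logz)) γ₁ k x))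
          {x : ℝ | 0 < x ∧ x ≤ γ₁ ∧ ∀ i, i ≤ k → 1 / γ₁ ^ 2 ≤ Y (betaOfRecord₁₃Ax F 2 (theta13OfThm1CCMWZBAx F 2 j (1 / 2) a₀ ε₀ ε₂₉ B₃ B₃' a₀ a₁ Efl logz)) γ₁ i x}

/-- The body PROJECTS to door (α_cof)-Ax (= the junction's §1, re-proved over the named shape so this file stays junction-free). [cite: Balaban1987RG1, Thm 1 p.259, Thm 3 p.264 (bookkeeping)] -/
theorem k0BoxCofinalRadiiAx_of_cofinalBetaSocketAxBody (h : ∀ F : T4Family, ∀ a : ℝ, 0 < a → CofinalBetaSocketAxBody F a) :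
    K0V23Stub3DoorSuppliersAx.K0BoxCofinalRadiiAx := by
  intro F a ha
  obtain ⟨a₀, ha₀, hle, γ₀, ε₂₉, β', j, ε₀, B₃, B₃', a₁, Efl, logz, hγ₀, hε, hlow, hup, -⟩ := h F a ha
  exact ⟨a₀, ha₀, hle, γ₀, ε₂₉, β', j, ε₀, B₃, B₃', a₁, Efl, logz, hγ₀, hε, hlow, hup⟩

/-- ★★ **THE K1ᴬ SOCKET FACE OF THE MOMENT CURRENCY — the typed LENS-P3 edge table at K1ᴬ.**  (L-absmom-box) at a radius `a₀ ≤ a` on a level `γ₀ ≤ ½` supplies the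
|β| HALF of the socket — the box (`β′ := M`) and row (i) (`b := 0`, `r := M`) at any level `γ₁ ≤ γ₀` — and EXACTLY the partial-sum FLOOR (iv) (the AF-sign content of
[I] (5.38)–(5.44): SIGNED information no kernel-size letter carries) and the history-CONTINUITY (C) of the `limUnder`-valued second moment ([I] §1 pp.263–264, asserted without
proof) remain DISPLAYED as hypotheses.  Neither (iv) nor (C) was ever fed by (5.10)-decay either: the moment currency loses no K1ᴬ edge.  CONDITIONAL; nothing asserted.
[cite: Balaban1987RG1, Thm 3 p.264, (0.20) p.256, (1.22) p.264, (5.38)–(5.44) pp.296–297, (5.42) p.297, §1 pp.263–264] -/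
theorem cofinalBetaSocketAxBody_of_absMomentBox_of_floor_of_cont {a γ₀ M γ₁ M' : ℝ} (ha₀ : 0 < a₀) (hle : a₀ ≤ a) (hγ₀ : 0 < γ₀) (hγh : γ₀ ≤ 1 / 2)
    (hε : 0 < ε₂₉) (h : RecordPlimAbsMomentOnBoxAx F a₀ ε₂₉ γ₀ M) (hγ₁ : 0 < γ₁) (hγ₁le : γ₁ ≤ γ₀)
    (hfloor : ∀ (n : ℕ) (gs : ℕ → ℝ), RGEqH n (betaOfRecord₁₃Ax F 2 (thetaFill F a₀ ε₂₉)) gs → Step.InInterval γ₁ n gs →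
      ∀ k, k ≤ n → -M' ≤ ∑ i ∈ Finset.Ico k n, betaOfRecord₁₃Ax F 2 (thetaFill F a₀ ε₂₉) i (prefixOf gs i))
    (hcont : ∀ k : ℕ, ContinuousOn (fun x : ℝ => betaOfRecord₁₃Ax F 2 (thetaFill F a₀ ε₂₉) k (clampPrefix (betaOfRecord₁₃Ax F 2 (thetaFill F a₀ ε₂₉)) γ₁ k x))
      {x : ℝ | 0 < x ∧ x ≤ γ₁ ∧ ∀ i, i ≤ k → 1 / γ₁ ^ 2 ≤ Y (betaOfRecord₁₃Ax F 2 (thetaFill F a₀ ε₂₉)) γ₁ i x}) :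
    CofinalBetaSocketAxBody F a := by
  obtain ⟨hup, hlow⟩ := betaBox_thetaFill_of_recordPlimAbsMomentOnBoxAx F a₀ ε₂₉ hγh h
  have hrow : ∀ (n : ℕ) (gs : ℕ → ℝ), RGEqH n (betaOfRecord₁₃Ax F 2 (thetaFill F a₀ ε₂₉)) gs → Step.InInterval γ₁ n gs →
      ∀ k, k ≤ n → |betaOfRecord₁₃Ax F 2 (thetaFill F a₀ ε₂₉) k (prefixOf gs k) - 0| ≤ M := by
    intro n gs _ hI k hk
    have hv : prefixOf gs k ∈ Box γ₀ k := box_mono hγ₁le (prefixOf_mem_box_of_inInterval hI hk)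
    rw [sub_zero]
    exact abs_le.mpr ⟨hlow k _ hv, hup k _ hv⟩
  exact ⟨a₀, ha₀, hle, γ₀, ε₂₉, M, 0, 0, 0, 0, 0, fun _ _ => 0, fun _ _ => 0, hγ₀, hε, hlow, hup, fun _ => 0, M, γ₁, M', hγ₁, hrow, hfloor, hcont⟩

/-- … so a producer of (L-absmom-box) + (iv) + (C) at every family and ceiling inhabits K0ᴬ on BOTH roads: through the socket's projection (this theorem) and through
§5's (α_cof) road directly (`record13SepCoPHInhabitedAx_of_k0AbsMomentBoxCofinalRadiiAx`, which does not even read (iv)∕(C)).  Bookkeeping; K0ᴬ OPEN.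
[cite: Balaban1987RG1, Thm 1 p.259, Thm 3 p.264 (bookkeeping)] -/
theorem record13SepCoPHInhabitedAx_of_cofinalBetaSocketAxBody (h : ∀ F : T4Family, ∀ a : ℝ, 0 < a → CofinalBetaSocketAxBody F a) :
    Summit.QuantumFields.YangMills.Theses.BalabanUVNodes.Record13SepCoPHInhabitedAx :=
  K0V23Stub3DoorSuppliersAx.record13SepCoPHInhabitedAx_of_k0BoxCofinalRadii (k0BoxCofinalRadiiAx_of_cofinalBetaSocketAxBody h)

/-! ### Closing the order diagram: every supplier shape reaches K0ᴬ BY NAME, so no lemma above is idle -/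

/-- **W-UDR-Ax's BOX analogue ⟹ K0ᴬ, FACTORING THROUGH (μ_cof^box)-Ax**: (5.10)-decay of the record's re-centred LIMIT kernel on the box at cofinal radii (the box receipt
`PlimDecayOnBoxOf` at `recordTermsAx`) ⟹ K0ᴬ; the rate enters only as `M := β′₅.₁₀`.  CONDITIONAL helper; K0ᴬ OPEN. [cite: Balaban1987RG1, Thm 1 p.259, Thm 3 p.264, (1.21)–(1.22) p.264, (5.10) p.293, (5.42) p.297] -/
theorem record13SepCoPHInhabitedAx_of_plimDecayOnBox_cofinalRadii
    (H : ∀ F : T4Family, ∀ a : ℝ, 0 < a → ∃ a₀ : ℝ, 0 < a₀ ∧ a₀ ≤ a ∧ ∃ γ₀ ε₂₉ C δ₁ : ℝ, 0 < γ₀ ∧ γ₀ ≤ 1 / 2 ∧ 0 < ε₂₉ ∧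
      (letI θ := thetaFill F a₀ ε₂₉
       letI := θ.instVβ₁; letI := θ.instVβ₂; letI := θ.instιβ
       PlimDecayOnBoxOf F (recordTermsAx F a₀ ε₂₉) θ.ρ8 θ.bV γ₀ C δ₁)) :
    Summit.QuantumFields.YangMills.Theses.BalabanUVNodes.Record13SepCoPHInhabitedAx := by
  refine record13SepCoPHInhabitedAx_of_k0AbsMomentBoxCofinalRadiiAx fun F a ha => ?_
  obtain ⟨a₀, ha₀, hle, γ₀, ε₂₉, C, δ₁, hγ₀, hγh, hε, hdec⟩ := H F a ha
  exact ⟨a₀, ha₀, hle, γ₀, ε₂₉, betaPrime510 4 C δ₁, hγ₀, hγh, hε, recordPlimAbsMomentOnBoxAx_of_plimDecayOnBoxOf F a₀ ε₂₉ hdec⟩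

/-- **The FINITE-VOLUME decay receipts on the box at cofinal radii ⟹ K0ᴬ, FACTORING THROUGH (μ_cof^box,vol)-Ax** ((1.21) box letter + pointwise-eventual (5.10) per volume).
CONDITIONAL helper; K0ᴬ OPEN. [cite: Balaban1987RG1, Thm 1 p.259, Thm 3 p.264, (1.20)–(1.22) p.264, (4.37) p.291, (5.10) p.293, (5.42) p.297] -/
theorem record13SepCoPHInhabitedAx_of_pvolDecayEvOnBox_cofinalRadii
    (H : ∀ F : T4Family, ∀ a : ℝ, 0 < a → ∃ a₀ : ℝ, 0 < a₀ ∧ a₀ ≤ a ∧ ∃ γ₀ ε₂₉ C δ₁ : ℝ, 0 < γ₀ ∧ γ₀ ≤ 1 / 2 ∧ 0 < ε₂₉ ∧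
      (letI θ := thetaFill F a₀ ε₂₉
       letI := θ.instVβ₁; letI := θ.instVβ₂; letI := θ.instιβ
       PolLimitOnBoxOf F (recordTermsAx F a₀ ε₂₉) θ.ρ8 θ.bV γ₀) ∧
      (letI θ := thetaFill F a₀ ε₂₉
       letI := θ.instVβ₁; letI := θ.instVβ₂; letI := θ.instιβ
       PvolDecayEvOnBoxOf F (recordTermsAx F a₀ ε₂₉) θ.ρ8 θ.bV γ₀ C δ₁)) :
    Summit.QuantumFields.YangMills.Theses.BalabanUVNodes.Record13SepCoPHInhabitedAx := by
  refine record13SepCoPHInhabitedAx_of_k0PvolAbsMomentBoxCofinalRadiiAx fun F a ha => ?_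
  obtain ⟨a₀, ha₀, hle, γ₀, ε₂₉, C, δ₁, hγ₀, hγh, hε, hlim, hdec⟩ := H F a ha
  exact ⟨a₀, ha₀, hle, γ₀, ε₂₉, betaPrime510 4 C δ₁, hγ₀, hγh, hε, hlim, recordPvolAbsMomentOnBoxAx_of_pvolDecayEvOnBoxOf F a₀ ε₂₉ hdec⟩

/-- **dag-n07-w3's moment face SHAPE (`∀ S ∀ᶠ K`), read at the record names and only at COFINAL radii ⟹ K0ᴬ** (their face asks EVERY radius and goes through the
token-free core; here the radius is cofinal and the road is (μ_cof^box,vol) ⟹ (α_cof)).  CONDITIONAL helper; K0ᴬ OPEN. [cite: Balaban1987RG1, Thm 1 p.259, Thm 3 p.264, (1.20)–(1.22) p.264, (5.42) p.297] -/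
theorem record13SepCoPHInhabitedAx_of_finsetEventuallyAbsMomentOnBox_cofinalRadii
    (H : ∀ F : T4Family, ∀ a : ℝ, 0 < a → ∃ a₀ : ℝ, 0 < a₀ ∧ a₀ ≤ a ∧ ∃ γ₀ ε₂₉ M : ℝ, 0 < γ₀ ∧ γ₀ ≤ 1 / 2 ∧ 0 < ε₂₉ ∧
      (letI θ := thetaFill F a₀ ε₂₉
       letI := θ.instVβ₁; letI := θ.instVβ₂; letI := θ.instιβ
       PolLimitOnBoxOf F (recordTermsAx F a₀ ε₂₉) θ.ρ8 θ.bV γ₀) ∧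
      ∀ (k : ℕ) (v : Fin (k + 1) → ℝ), v ∈ Box γ₀ k → ∀ S : Finset (Fin 4 → ℤ), ∀ᶠ K in atTop,
        ∑ z ∈ S, |recordPvolAx F a₀ ε₂₉ k v K 0 1 z| * |(z 0 : ℝ)| * |(z 1 : ℝ)| ≤ M) :
    Summit.QuantumFields.YangMills.Theses.BalabanUVNodes.Record13SepCoPHInhabitedAx := by
  refine record13SepCoPHInhabitedAx_of_k0PvolAbsMomentBoxCofinalRadiiAx fun F a ha => ?_
  obtain ⟨a₀, ha₀, hle, γ₀, ε₂₉, M, hγ₀, hγh, hε, hlim, hS⟩ := H F a ha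
  exact ⟨a₀, ha₀, hle, γ₀, ε₂₉, M, hγ₀, hγh, hε, hlim, recordPvolAbsMomentOnBoxAx_of_finsetEventually F a₀ ε₂₉ hS⟩

/-- **A producer of (L-absmom-box) + the floor (iv) + the continuity (C) at cofinal radii inhabits the junction socket at every `(F, a)`, hence K0ᴬ** (and, through the Ax
K1 face with its displayed children, serves K1ᴬ — not typed here).  CONDITIONAL helper; K0ᴬ ∕ K1ᴬ OPEN. [cite: Balaban1987RG1, Thm 1 p.259, Thm 3 p.264, (0.20) p.256, (1.22) p.264, (5.38)–(5.44) pp.296–297, §1 pp.263–264] -/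
theorem record13SepCoPHInhabitedAx_of_absMomentBox_floor_cont_cofinalRadii
    (H : ∀ F : T4Family, ∀ a : ℝ, 0 < a → ∃ a₀ ε₂₉ γ₀ M γ₁ M' : ℝ, 0 < a₀ ∧ a₀ ≤ a ∧ 0 < γ₀ ∧ γ₀ ≤ 1 / 2 ∧ 0 < ε₂₉ ∧
      RecordPlimAbsMomentOnBoxAx F a₀ ε₂₉ γ₀ M ∧ 0 < γ₁ ∧ γ₁ ≤ γ₀ ∧
      (∀ (n : ℕ) (gs : ℕ → ℝ), RGEqH n (betaOfRecord₁₃Ax F 2 (thetaFill F a₀ ε₂₉)) gs → Step.InInterval γ₁ n gs →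
        ∀ k, k ≤ n → -M' ≤ ∑ i ∈ Finset.Ico k n, betaOfRecord₁₃Ax F 2 (thetaFill F a₀ ε₂₉) i (prefixOf gs i)) ∧
      ∀ k : ℕ, ContinuousOn (fun x : ℝ => betaOfRecord₁₃Ax F 2 (thetaFill F a₀ ε₂₉) k (clampPrefix (betaOfRecord₁₃Ax F 2 (thetaFill F a₀ ε₂₉)) γ₁ k x))
        {x : ℝ | 0 < x ∧ x ≤ γ₁ ∧ ∀ i, i ≤ k → 1 / γ₁ ^ 2 ≤ Y (betaOfRecord₁₃Ax F 2 (thetaFill F a₀ ε₂₉)) γ₁ i x}) :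
    Summit.QuantumFields.YangMills.Theses.BalabanUVNodes.Record13SepCoPHInhabitedAx := by
  refine record13SepCoPHInhabitedAx_of_cofinalBetaSocketAxBody fun F a ha => ?_
  obtain ⟨a₀, ε₂₉, γ₀, M, γ₁, M', ha₀, hle, hγ₀, hγh, hε, h, hγ₁, hγ₁le, hfloor, hcont⟩ := H F a ha
  exact cofinalBetaSocketAxBody_of_absMomentBox_of_floor_of_cont F a₀ ε₂₉ ha₀ hle hγ₀ hγh hε h hγ₁ hγ₁le hfloor hcont


/-! ## §5d  [E]-HEADED RATE-FREE DOORS (★★★ director-ym №526 (i): «[E] `K0AxTwoVolumeRate.RecordPvolTwoVolExpOnRunsAx` = the common first letter of both K0ᴬ doors»;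
(L-lim) ⟸ [E] is ✓`K0AxTwoVolumeRate.recordPolLimitOnRunsAx_of_twoVolExp`).  LENS P3: in ✓`K0AxTwoVolumeRate.record13SepCoPHInhabitedAx_of_twoVolExp_pvolDecayEv_tokFree`
the second letter is the per-volume EVENTUAL (5.10)-DECAY supply `hDec` (a RATE `(C, δ₁)`); here it is replaced by the WEAKER per-volume windowed ABSOLUTE-MOMENT supply
(`RecordPvolAbsMomentOnRunsAx`, NO rate; `hDec ⟹ hVmom` by ✓`recordPvolAbsMomentOnRunsAx_of_pvolDecayEv`, `M := β′₅.₁₀(4, C, δ₁)`), on both roads (JOIN ∕ cofinal radii).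
CONDITIONAL helpers; [E], (V-absmom), P0 are OPEN Bałaban-strength hypotheses; K0ᴬ OPEN; the mass gap is NOT proved. -/

/-- **[E] ∧ (V-absmom), both in THRESHOLD form under the JOIN antecedents at token `Tok` ⟹ `JoinConclVolMomR Tok F`** (`ε₂₉ := min εL εV`, `γ₀ := min γ₀ᴱ γ₀ⱽ`; (L-lim) from [E] by
✓`recordPolLimitOnRunsAx_of_twoVolExp`).  Threshold ⟹ inhabitation, the legitimate direction (◆ CRIT-1 g35 l.4796 ε₂₉-form note). [cite: Balaban1987RG1, Thm 1 p.259, (1.7) p.261, (1.21)–(1.22) p.264, (4.37) p.291, (5.42) p.297] -/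
theorem joinConclVolMomR_of_twoVolExp_pvolAbsMoment_threshold {Tok : T4Family → ℕ → ℝ → Prop} {F : T4Family}
    (hE : ∃ Mth : ℕ, ∀ Mc : ℕ, Mth ≤ Mc → ∀ (j c c₀ c₁ : ℕ) (B₃ B₃' a₀ a₁ : ℝ), JoinAntecedents Tok F Mc j c c₀ c₁ B₃ B₃' a₀ a₁ →
      ∃ εL : ℝ, 0 < εL ∧ ∀ ε₂₉ : ℝ, 0 < ε₂₉ → ε₂₉ ≤ εL → ∃ γ₀ : ℝ, 0 < γ₀ ∧ ∀ γ : ℝ, γ ≤ γ₀ →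
        ∃ E₀ κ : ℝ, RecordPvolTwoVolExpOnRunsAx F a₀ ε₂₉ γ E₀ κ)
    (hVmom : ∃ Mth : ℕ, ∀ Mc : ℕ, Mth ≤ Mc → ∀ (j c c₀ c₁ : ℕ) (B₃ B₃' a₀ a₁ : ℝ), JoinAntecedents Tok F Mc j c c₀ c₁ B₃ B₃' a₀ a₁ →
      ∃ εV : ℝ, 0 < εV ∧ ∀ ε₂₉ : ℝ, 0 < ε₂₉ → ε₂₉ ≤ εV → ∃ γ₀ M : ℝ, 0 < γ₀ ∧ ∀ γ : ℝ, γ ≤ γ₀ → RecordPvolAbsMomentOnRunsAx F a₀ ε₂₉ γ M) :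
    JoinConclVolMomR Tok F := by
  obtain ⟨MthE, hJE⟩ := hE
  obtain ⟨MthV, hJV⟩ := hVmom
  refine ⟨max MthE MthV, fun Mc hMc j c c₀ c₁ B₃ B₃' a₀ a₁ hA => ?_⟩
  obtain ⟨εL, hεL, hL⟩ := hJE Mc (le_trans (le_max_left _ _) hMc) j c c₀ c₁ B₃ B₃' a₀ a₁ hA
  obtain ⟨εV, hεV, hV⟩ := hJV Mc (le_trans (le_max_right _ _) hMc) j c c₀ c₁ B₃ B₃' a₀ a₁ hA
  obtain ⟨γE, hγE, hEγ⟩ := hL (min εL εV) (lt_min hεL hεV) (min_le_left _ _)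
  obtain ⟨γV, M, hγV, hVγ⟩ := hV (min εL εV) (lt_min hεL hεV) (min_le_right _ _)
  refine ⟨min γE γV, min εL εV, M, lt_min hγE hγV, lt_min hεL hεV, fun γ hγ => ⟨?_, hVγ γ (le_trans hγ (min_le_right _ _))⟩⟩
  obtain ⟨E₀, κ, hEx⟩ := hEγ γ (le_trans hγ (min_le_left _ _))
  exact recordPolLimitOnRunsAx_of_twoVolExp F a₀ _ hEx

/-- ★★★ **THE K0ᴬ DOOR FROM [E] ∧ (V-absmom) ∧ P0, BY NAME — the RATE-FREE sibling of ✓`K0AxTwoVolumeRate.record13SepCoPHInhabitedAx_of_twoVolExp_pvolDecayEv_tokFree`**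
(`hE` VERBATIM theirs; `hVmom` = per-volume windowed absolute second moments frequently in the volume, threshold form, in place of their rated `hDec`; (R-Uk) ∕ (R-Bg) binders VERBATIM
from ✓`K0AxMomentDoor.record13SepCoPHInhabitedAx_of_mom_residual_tokFree`).  Road: [E] ⟹ (L-lim); (L-lim) ∧ (V-absmom) = `JoinConclVolMomR ⊤` ⟹ `JoinConclMomR ⊤` (Fatou through
the windows) ⟹ K0ᴬ.  CONDITIONAL helper; nothing of Bałaban asserted, ported or discharged; K0ᴬ OPEN; the mass gap is NOT proved.
[cite: Balaban1987RG1, Thm 1 p.259, Thm 3 p.264, (1.7) p.261, (1.21)–(1.22) p.264, (4.37) p.291, (5.42) p.297; Balaban1985Variational, Thm 1 (8)–(9) p.279; Balaban1988Convergent, Thm 1 p.262] -/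
theorem record13SepCoPHInhabitedAx_of_twoVolExp_pvolAbsMoment_tokFree
    (hE : ∀ F : T4Family, ∃ Mth : ℕ, ∀ Mc : ℕ, Mth ≤ Mc → ∀ (j c c₀ c₁ : ℕ) (B₃ B₃' a₀ a₁ : ℝ), JoinAntecedents (fun _ _ _ => True) F Mc j c c₀ c₁ B₃ B₃' a₀ a₁ →
      ∃ εL : ℝ, 0 < εL ∧ ∀ ε₂₉ : ℝ, 0 < ε₂₉ → ε₂₉ ≤ εL → ∃ γ₀ : ℝ, 0 < γ₀ ∧ ∀ γ : ℝ, γ ≤ γ₀ →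
        ∃ E₀ κ : ℝ, RecordPvolTwoVolExpOnRunsAx F a₀ ε₂₉ γ E₀ κ)
    (hVmom : ∀ F : T4Family, ∃ Mth : ℕ, ∀ Mc : ℕ, Mth ≤ Mc → ∀ (j c c₀ c₁ : ℕ) (B₃ B₃' a₀ a₁ : ℝ), JoinAntecedents (fun _ _ _ => True) F Mc j c c₀ c₁ B₃ B₃' a₀ a₁ →
      ∃ εV : ℝ, 0 < εV ∧ ∀ ε₂₉ : ℝ, 0 < ε₂₉ → ε₂₉ ≤ εV → ∃ γ₀ M : ℝ, 0 < γ₀ ∧ ∀ γ : ℝ, γ ≤ γ₀ → RecordPvolAbsMomentOnRunsAx F a₀ ε₂₉ γ M)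
    (hUk : ∀ F : T4Family, ∃ aU : ℝ, 0 < aU ∧ ∀ (B₃ a₀ a₁ : ℝ), 2 * (F.L : ℝ) ^ 2 ≤ B₃ → 0 < a₀ → a₀ ≤ aU → 0 < a₁ → ∃ M₀ : ℕ, ∀ Mc : ℕ, McGuard F Mc → M₀ ≤ Mc →
      (∀ ε₁ : ℝ, 0 < ε₁ → ε₁ ≤ a₁ → B₃ * ε₁ ≤ a₀ → ∀ (k n : ℕ) (V : Literature.MathematicalPhysics.QuantumFieldTheory.Balaban1983to89.GaugeField (F.P (Summit.QuantumFields.YangMills.Theorems.K0RecordFormatNames.recordK₀ F Mc k + n)) (k + 1) (Literature.MathematicalPhysics.QuantumFieldTheory.Balaban1983to89.Node00.SU 2)), Literature.MathematicalPhysics.QuantumFieldTheory.Balaban1983to89.PlaqSmall ε₁ V → Literature.MathematicalPhysics.QuantumFieldTheory.Balaban1983to89.Node00.UkExists F 2 (Summit.QuantumFields.YangMills.Theorems.K0RecordFormatNames.recordK₀ F Mc k + n) (k + 1) a₀ V ∧ Literature.MathematicalPhysics.QuantumFieldTheory.Balaban1983to89.Node00.UniqueUkOrbit F 2 (Summit.QuantumFields.YangMills.Theorems.K0RecordFormatNames.recordK₀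 F Mc k + n) (k + 1) a₀ V))
    (hBg : ∀ F : T4Family, ∃ aB : ℝ, 0 < aB ∧ ∀ a₀ : ℝ, 0 < a₀ → a₀ ≤ aB → ∃ M₀ : ℕ, ∀ Mc : ℕ, McGuard F Mc → M₀ ≤ Mc →
      (∀ (k n : ℕ) (ε₂₉ : ℝ), 0 < ε₂₉ → letI θ := Summit.QuantumFields.YangMills.Theorems.K0RecordFormatNames.thetaFill F a₀ ε₂₉; letI := θ.instVβ₁; letI := θ.instVβ₂; letI := θ.instιβ; AnalyticAt ℝ (fun B : Summit.QuantumFields.YangMills.Theorems.K0RecordFormatNames.recordW F a₀ ε₂₉ k (Summit.QuantumFields.YangMills.Theorems.K0RecordFormatNames.recordK₀ F Mc k + n) => fun (b : Literature.MathematicalPhysics.QuantumFieldTheory.Balaban1983to89.PBond (F.P (Summit.QuantumFields.YangMills.Theorems.K0RecordFormatNames.recordK₀ F Mc k + n)) 0) (i i' : Fin 2) => ((Summit.QuantumFields.YangMills.Theorems.K0RecordFormatNames.recordBgField F θ k (Summit.QuantumFields.YangMills.Theorems.K0RecordFormatNames.recordK₀ F Mc k + n) B b : Literature.MathematicalPhysics.QuantumFieldTheory.Balaban1983to89.Node00.SU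 2) : Matrix (Fin 2) (Fin 2) ℂ) i i') 0)) :
    Summit.QuantumFields.YangMills.Theses.BalabanUVNodes.Record13SepCoPHInhabitedAx :=
  record13SepCoPHInhabitedAx_of_mom_residual_tokFree (fun F => joinConclMomR_of_joinConclVolMomR (joinConclVolMomR_of_twoVolExp_pvolAbsMoment_threshold (hE F) (hVmom F))) hUk hBg

/-- ★★★ **THE COFINAL-RADII K0ᴬ DOOR HEADED BY [E]**: at cofinally small radii, [E] at level `γ₀ ≤ ½` ∧ (V-absmom) `RecordPvolAbsMomentOnRunsAx … γ₀ M` ⟹ K0ᴬ BY NAME, through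
✓`K0AxMomentDoor`'s (μ_cof^vol)-Ax ((L-lim) from [E]).  No P0, no JOIN, no rate on the volume side.  CONDITIONAL helper; K0ᴬ OPEN; the mass gap is NOT proved.
[cite: Balaban1987RG1, Thm 1 p.259, Thm 3 p.264, (0.20) p.256, (1.7) p.261, (1.21)–(1.22) p.264, (4.37) p.291, (5.42) p.297] -/
theorem record13SepCoPHInhabitedAx_of_twoVolExp_pvolAbsMoment_cofinalRadii
    (H : ∀ F : T4Family, ∀ a : ℝ, 0 < a → ∃ a₀ : ℝ, 0 < a₀ ∧ a₀ ≤ a ∧ ∃ γ₀ ε₂₉ E₀ κ M : ℝ, 0 < γ₀ ∧ γ₀ ≤ 1 / 2 ∧ 0 < ε₂₉ ∧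
      RecordPvolTwoVolExpOnRunsAx F a₀ ε₂₉ γ₀ E₀ κ ∧ RecordPvolAbsMomentOnRunsAx F a₀ ε₂₉ γ₀ M) :
    Summit.QuantumFields.YangMills.Theses.BalabanUVNodes.Record13SepCoPHInhabitedAx := by
  refine record13SepCoPHInhabitedAx_of_k0PvolAbsMomentCofinalRadiiAx fun F a ha => ?_
  obtain ⟨a₀, ha₀, hle, γ₀, ε₂₉, E₀, κ, M, hγ₀, hγh, hε, hEx, hV⟩ := H F a ha
  exact ⟨a₀, ha₀, hle, γ₀, ε₂₉, M, hγ₀, hγh, hε, recordPolLimitOnRunsAx_of_twoVolExp F a₀ ε₂₉ hEx, hV⟩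

end Summit.QuantumFields.YangMills.Theorems.K0AxMomentRoad

end
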